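import Mathlib
import Summits.Ventures.PercRepro2.Defs
import Summits.Ventures.PercRepro2.Independence
import Summits.Ventures.PercRepro2.Graph
import Summits.Ventures.PercRepro2.Exploration
import Summits.Ventures.PercRepro2.Induced
import Summits.Ventures.PercRepro2.R2PrimeThreeReduction
import Summits.Ventures.PercRepro2.YBridge
import Summits.Ventures.PercRepro2.HCov
import Summits.Ventures.PercRepro2.HubModel
import Summits.Ventures.PercRepro2.HubLaw
import Summits.Ventures.PercRepro2.HubRootLaw
import Summits.Ventures.PercRepro2.HubConn
import Summits.Ventures.PercRepro2.HubBernstein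

/-!
# The covariance form `Gc` on the class R as a cubic in Bernstein-1 forms
(blind cell PercRepro2, typer-1 g8; MINE2-HUB.md §2 (a)–(b), HUB-LEAN-SCOPE.md (S3b))

Every mass of `CovForm.Gc` (HCov.lean) is the probability of a Boolean combination of the
connection events between the five marks, hence of a hub event (`HubConn.toEvent`); every
*signed* combination of such masses is the Bernstein-1 form `massZ q Φ m = bform q (tableZ Φ m)`
of a **ℤ-valued hub function** `Φ : HubFn` (`tableZ Φ m w = Σ_π Φ w π · m_π`).  With the twelve
hub functions `fQ, fPD, fDo, fgap, fEQbo, fEQb3, fEQb3o, fEQo, fEQ3, fEQ3o, fPDb, fPDbo`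
(the twelve linear forms of HCov.lean, each an integer combination of at most eight hub
events) the form becomes (`Gc_eq_GcB`, for an injective marking of the class R)

`Gc = GcB q m`, `GcB q m := M(fQ)·(M(fPD)·M(fEQbo) + M(fDo)·M(fEQb3) − M(fPD)·M(fEQb3o))
  + M(fgap)·(M(fPD)·M(fEQo) + M(fDo)·M(fEQ3) − M(fPD)·M(fEQ3o))
  + M(fQ)·(M(fDo)·M(fPDb) − M(fPD)·M(fPDbo))`, `M := massZ q · m`,

with `q = bundleProb` the seven bundle weights and `m_π = P(Π = π)` the inner masses —
eight products of three Bernstein-1 forms, which regroup (`HubBernstein.bform_mul_mul`) into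
`GcB q m = Σ_k bern q k · Ck m k` (`GcB_eq_sum`, section `Table`) with the coefficient cubics
`Ck m k = cub (Wtot k) m`, `Wtot k` = the signed sum of the eight integer hub tables `wZ` = mine-2's
hub table `W_k(π¹, π², π³)` (MINE2-HUB.md §2 (b)); `GcB_nonneg`: `0 ≤ GcB q m` once `q ∈ [0, 1]^7`
and every `C_k(m) ≥ 0`.
-/

namespace Summit.Ventures.PercRepro2.Hub

open UnionCluster

variable {V : Type*} {E : Type*}

/-- The marking of the five marks by five vertices. -/
def markOf (o a₁ a₂ a₃ b : V) : Mark → V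
  | .o => o
  | .a₁ => a₁
  | .a₂ => a₂
  | .a₃ => a₃
  | .b => b

section HubFn

variable {R : Type*} [CommRing R]

/-- A ℤ-valued hub function: a signed combination of hub events. -/
abbrev HubFn := (Fin 7 → Bool) → (Fin 3 → Bool) → ℤ

/-- The indicator of a hub event. -/
def ind (Ψ : HubEvt) : HubFn := fun w π => if Ψ w π then 1 else 0

/-- The coefficient table of a hub function with inner masses `m`: `Σ_π Φ w π · m_π`. -/
def tableZ (Φ : HubFn) (m : (Fin 3 → Bool) → R) : (Fin 7 → Bool) → R :=
  fun w => ∑ π, (Φ w π : R) * m π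

/-- The table of an indicator is the table of the event. -/
lemma tableZ_ind (Ψ : HubEvt) (m : (Fin 3 → Bool) → R) : tableZ (ind Ψ) m = tableOf Ψ m := by
  funext w
  unfold tableZ tableOf ind
  refine Finset.sum_congr rfl fun π _ => ?_
  split_ifs <;> simp

/-- Tables are additive. -/
lemma tableZ_add (Φ₁ Φ₂ : HubFn) (m : (Fin 3 → Bool) → R) :
    tableZ (Φ₁ + Φ₂) m = tableZ Φ₁ m + tableZ Φ₂ m := by
  funext w
  simp only [tableZ, Pi.add_apply, Int.cast_add, add_mul, Finset.sum_add_distrib]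

/-- Tables are subtractive. -/
lemma tableZ_sub (Φ₁ Φ₂ : HubFn) (m : (Fin 3 → Bool) → R) :
    tableZ (Φ₁ - Φ₂) m = tableZ Φ₁ m - tableZ Φ₂ m := by
  funext w
  simp only [tableZ, Pi.sub_apply, Int.cast_sub, sub_mul, Finset.sum_sub_distrib]

/-- Bernstein-1 forms are additive in the table. -/
lemma bform_add {ι : Type*} [Fintype ι] [DecidableEq ι] (q : ι → R) (f g : (ι → Bool) → R) :
    bform q (f + g) = bform q f + bform q g := by
  simp only [bform, Pi.add_apply, mul_add, Finset.sum_add_distrib]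

/-- Bernstein-1 forms are subtractive in the table. -/
lemma bform_sub {ι : Type*} [Fintype ι] [DecidableEq ι] (q : ι → R) (f g : (ι → Bool) → R) :
    bform q (f - g) = bform q f - bform q g := by
  simp only [bform, Pi.sub_apply, mul_sub, Finset.sum_sub_distrib]

/-- The Bernstein-1 mass of a hub function: `bform q (tableZ Φ m)`. -/
def massZ (q : Fin 7 → R) (Φ : HubFn) (m : (Fin 3 → Bool) → R) : R := bform q (tableZ Φ m)

/-- Masses are additive. -/
lemma massZ_add (q : Fin 7 → R) (Φ₁ Φ₂ : HubFn) (m : (Fin 3 → Bool) → R) :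
    massZ q (Φ₁ + Φ₂) m = massZ q Φ₁ m + massZ q Φ₂ m := by
  rw [massZ, massZ, massZ, tableZ_add, bform_add]

/-- Masses are subtractive. -/
lemma massZ_sub (q : Fin 7 → R) (Φ₁ Φ₂ : HubFn) (m : (Fin 3 → Bool) → R) :
    massZ q (Φ₁ - Φ₂) m = massZ q Φ₁ m - massZ q Φ₂ m := by
  rw [massZ, massZ, massZ, tableZ_sub, bform_sub]

end HubFn

section Events

/-- `{s ↮ x}` is the complement of the connection event. -/
lemma avoidAll_singleton_eq (ends : E → Sym2 V) (s x : V) :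
    avoidAll ends s {x} = (connEvent ends s x)ᶜ := by
  ext ω
  simp only [avoidAll, Set.mem_setOf_eq, Finset.mem_singleton, forall_eq, Set.mem_compl_iff,
    mem_connEvent]

variable {R : Type*} [CommRing R] [Fintype E] [DecidableEq E] [DecidableEq V]
  {ends : E → Sym2 V} {μ : Mark → V}

/-- **The probability of a hub event is the mass of its indicator.** -/
theorem prob_toEvent_eq_massZ (hinj : Function.Injective μ) (p : E → R)
    (m : (Fin 3 → Bool) → R) (hm : ∀ π, prob p {ω | innerPat ends μ ω = π} = m π) (Ψ : HubEvt) :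
    prob p (toEvent ends μ Ψ) = massZ (bundleProb ends μ p) (ind Ψ) m := by
  rw [massZ, tableZ_ind, prob_toEvent_eq_bform hinj p Ψ m hm]

end Events

section Forms

/-- The connection hub event of two marks. -/
def cE (u v : Mark) : HubEvt := fun w π => reachOf w π u v

/-- `Q = {a₁ ↮ a₂}` (as `{a₂ ↮ a₁}`). -/
def hQ : HubEvt := fun w π => !reachOf w π .a₂ .a₁

/-- `T = {a₂ ↮ a₁, a₂ ↔ a₃}`. -/
def hT : HubEvt := fun w π => !reachOf w π .a₂ .a₁ && reachOf w π .a₂ .a₃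

/-- `T′ = {a₁ ↮ a₂, a₁ ↔ a₃}`. -/
def hT' : HubEvt := fun w π => !reachOf w π .a₁ .a₂ && reachOf w π .a₁ .a₃

/-- `PD = {a₁ ↮ a₂, a₃ ↮ a₁, a₃ ↮ a₂}`. -/
def hPD : HubEvt := fun w π => !reachOf w π .a₁ .a₂ && !(reachOf w π .a₃ .a₁ || reachOf w π .a₃ .a₂)

/-- Conjunction of hub events. -/
def hand (Ψ₁ Ψ₂ : HubEvt) : HubEvt := fun w π => Ψ₁ w π && Ψ₂ w π

/-- `o ∈ C₁`. -/
def o1 : HubEvt := cE .a₁ .o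
/-- `o ∈ C₂`. -/
def o2 : HubEvt := cE .a₂ .o
/-- `b ∈ C₁`. -/
def b1 : HubEvt := cE .a₁ .b
/-- `b ∈ C₂`. -/
def b2 : HubEvt := cE .a₂ .b

/-- `P(Q)`. -/
def fQ : HubFn := ind hQ
/-- `P(PD)`. -/
def fPD : HubFn := ind hPD
/-- `D_o = P(PD, o ∈ U)`. -/
def fDo : HubFn := ind (hand hPD o1) + ind (hand hPD o2)
/-- `gap = P(a₂ ↔ b) − P(a₁ ↔ b)`. -/
def fgap : HubFn := ind b2 - ind b1
/-- `E_Q[σ_b σ_o]`. -/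
def fEQbo : HubFn :=
  ind (hand hQ (hand o1 b1)) + ind (hand hQ (hand o2 b2)) - ind (hand hQ (hand o2 b1)) -
    ind (hand hQ (hand o1 b2))
/-- `E_Q[σ_b σ₃]`. -/
def fEQb3 : HubFn := ind (hand hT' b1) + ind (hand hT b2) - ind (hand hT b1) - ind (hand hT' b2)
/-- `E_Q[σ_b σ₃ 1_{o ∈ U}]`. -/
def fEQb3o : HubFn :=
  ind (hand hT' (hand o1 b1)) + ind (hand hT' (hand o2 b1)) + ind (hand hT (hand o1 b2)) +
    ind (hand hT (hand o2 b2)) - ind (hand hT (hand o1 b1)) - ind (hand hT (hand o2 b1)) -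
    ind (hand hT' (hand o1 b2)) - ind (hand hT' (hand o2 b2))
/-- `E_Q[σ_o]`. -/
def fEQo : HubFn := ind (hand hQ o1) - ind (hand hQ o2)
/-- `E_Q[σ₃]`. -/
def fEQ3 : HubFn := ind hT' - ind hT
/-- `E_Q[σ₃ 1_{o ∈ U}]`. -/
def fEQ3o : HubFn :=
  ind (hand hT' o1) + ind (hand hT' o2) - ind (hand hT o1) - ind (hand hT o2)
/-- `P(PD, b ∈ U)`. -/
def fPDb : HubFn := ind (hand hPD b1) + ind (hand hPD b2)
/-- `P(PD, b ∈ U, o ∈ U)`. -/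
def fPDbo : HubFn :=
  ind (hand hPD (hand o1 b1)) + ind (hand hPD (hand o2 b1)) + ind (hand hPD (hand o1 b2)) +
    ind (hand hPD (hand o2 b2))

variable {R : Type*} [CommRing R]

/-- **`Gc` as a cubic in the Bernstein-1 masses of the twelve hub functions** (the nested
formula of HCov.lean with `P(·)` replaced by `massZ q · m`). -/
def GcB (q : Fin 7 → R) (m : (Fin 3 → Bool) → R) : R :=
  massZ q fQ m * (massZ q fPD m * massZ q fEQbo m + massZ q fDo m * massZ q fEQb3 m -
      massZ q fPD m * massZ q fEQb3o m) +
    massZ q fgap m * (massZ q fPD m * massZ q fEQo m + massZ q fDo m * massZ q fEQ3 m -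
      massZ q fPD m * massZ q fEQ3o m) +
    massZ q fQ m * (massZ q fDo m * massZ q fPDb m - massZ q fPD m * massZ q fPDbo m)

end Forms

section Main

variable {R : Type*} [Field R] [Fintype E] [DecidableEq E] [DecidableEq V]

/-- **`Gc = GcB`** on the class R: the covariance form is the cubic `GcB` in the bundle weights
`q = bundleProb` and the inner masses `m_π = P(Π = π)`. -/
theorem Gc_eq_GcB (p : E → R) (ends : E → Sym2 V) (o a₁ a₂ a₃ b : V)
    (hinj : Function.Injective (markOf o a₁ a₂ a₃ b)) (hR : ClassR ends (markOf o a₁ a₂ a₃ b))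
    (m : (Fin 3 → Bool) → R)
    (hm : ∀ π, prob p {ω | innerPat ends (markOf o a₁ a₂ a₃ b) ω = π} = m π) :
    CovForm.Gc p ends o a₁ a₂ a₃ b = GcB (bundleProb ends (markOf o a₁ a₂ a₃ b) p) m := by
  have h12 : connEvent ends a₁ a₂ = toEvent ends (markOf o a₁ a₂ a₃ b) (cE .a₁ .a₂) :=
    connEvent_eq_toEvent hinj hR .a₁ .a₂
  have h21 : connEvent ends a₂ a₁ = toEvent ends (markOf o a₁ a₂ a₃ b) (cE .a₂ .a₁) :=
    connEvent_eq_toEvent hinj hR .a₂ .a₁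
  have h1o : connEvent ends a₁ o = toEvent ends (markOf o a₁ a₂ a₃ b) o1 :=
    connEvent_eq_toEvent hinj hR .a₁ .o
  have h2o : connEvent ends a₂ o = toEvent ends (markOf o a₁ a₂ a₃ b) o2 :=
    connEvent_eq_toEvent hinj hR .a₂ .o
  have h1b : connEvent ends a₁ b = toEvent ends (markOf o a₁ a₂ a₃ b) b1 :=
    connEvent_eq_toEvent hinj hR .a₁ .b
  have h2b : connEvent ends a₂ b = toEvent ends (markOf o a₁ a₂ a₃ b) b2 :=
    connEvent_eq_toEvent hinj hR .a₂ .b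
  have h13 : connEvent ends a₁ a₃ = toEvent ends (markOf o a₁ a₂ a₃ b) (cE .a₁ .a₃) :=
    connEvent_eq_toEvent hinj hR .a₁ .a₃
  have h23 : connEvent ends a₂ a₃ = toEvent ends (markOf o a₁ a₂ a₃ b) (cE .a₂ .a₃) :=
    connEvent_eq_toEvent hinj hR .a₂ .a₃
  have h31 : connEvent ends a₃ a₁ = toEvent ends (markOf o a₁ a₂ a₃ b) (cE .a₃ .a₁) :=
    connEvent_eq_toEvent hinj hR .a₃ .a₁
  have h32 : connEvent ends a₃ a₂ = toEvent ends (markOf o a₁ a₂ a₃ b) (cE .a₃ .a₂) :=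
    connEvent_eq_toEvent hinj hR .a₃ .a₂
  have hQe : avoidAll ends a₂ {a₁} = toEvent ends (markOf o a₁ a₂ a₃ b) hQ := by
    rw [avoidAll_singleton_eq, h21, ← toEvent_not]
    rfl
  have hTe : TEvent ends a₁ a₂ a₃ = toEvent ends (markOf o a₁ a₂ a₃ b) hT := by
    rw [TEvent, h21, h23, ← toEvent_not, ← toEvent_and]
    rfl
  have hT'e : TEvent ends a₂ a₁ a₃ = toEvent ends (markOf o a₁ a₂ a₃ b) hT' := by
    rw [TEvent, h12, h13, ← toEvent_not, ← toEvent_and]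
    rfl
  have hPDe : PDEvent ends a₁ a₂ a₃ = toEvent ends (markOf o a₁ a₂ a₃ b) hPD := by
    rw [PDEvent, Dtilde, inU, h12, h31, h32, ← toEvent_or, ← toEvent_not, ← toEvent_not,
      ← toEvent_and]
    rfl
  have hand' : ∀ Ψ₁ Ψ₂ : HubEvt, toEvent ends (markOf o a₁ a₂ a₃ b) Ψ₁ ∩
      toEvent ends (markOf o a₁ a₂ a₃ b) Ψ₂ = toEvent ends (markOf o a₁ a₂ a₃ b) (hand Ψ₁ Ψ₂) :=
    fun Ψ₁ Ψ₂ => (toEvent_and _ _ Ψ₁ Ψ₂).symm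
  unfold CovForm.Gc CovForm.DEF CovForm.EQbo CovForm.EQb3 CovForm.EQb3o CovForm.EQo CovForm.EQ3
    CovForm.EQ3o CovForm.PDb CovForm.PDbo CovForm.Do CovForm.gap
  rw [hQe, hTe, hT'e, hPDe, h1o, h2o, h1b, h2b]
  simp only [hand', prob_toEvent_eq_massZ hinj p m hm]
  unfold GcB fQ fPD fDo fgap fEQbo fEQb3 fEQb3o fEQo fEQ3 fEQ3o fPDb fPDbo
  simp only [massZ_add, massZ_sub]

end Main


section Table

variable {R : Type*} [CommRing R]

/-- A coefficient tensor on triples of inner patterns. -/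
abbrev Tensor3 := (Fin 3 → Bool) → (Fin 3 → Bool) → (Fin 3 → Bool) → ℤ

/-- **The integer hub table of three hub functions**:
`Σ_{prof w₁ w₂ w₃ = k} Φ₁ w₁ π₁ · Φ₂ w₂ π₂ · Φ₃ w₃ π₃`. -/
def wZ (Φ₁ Φ₂ Φ₃ : HubFn) (k : Fin 7 → Fin 4) : Tensor3 := fun π₁ π₂ π₃ =>
  ∑ t : (Fin 7 → Bool) × (Fin 7 → Bool) × (Fin 7 → Bool) with prof t.1 t.2.1 t.2.2 = k,
    Φ₁ t.1 π₁ * Φ₂ t.2.1 π₂ * Φ₃ t.2.2 π₃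

/-- The cubic in the inner masses with coefficient tensor `W`. -/
def cub (W : Tensor3) (m : (Fin 3 → Bool) → R) : R :=
  ∑ π₁, ∑ π₂, ∑ π₃, (W π₁ π₂ π₃ : R) * (m π₁ * m π₂ * m π₃)

/-- Cubics are additive in the tensor. -/
lemma cub_add (W₁ W₂ : Tensor3) (m : (Fin 3 → Bool) → R) :
    cub (W₁ + W₂) m = cub W₁ m + cub W₂ m := by
  simp only [cub, Pi.add_apply, Int.cast_add, add_mul, Finset.sum_add_distrib]

/-- Cubics are subtractive in the tensor. -/
lemma cub_sub (W₁ W₂ : Tensor3) (m : (Fin 3 → Bool) → R) :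
    cub (W₁ - W₂) m = cub W₁ m - cub W₂ m := by
  simp only [cub, Pi.sub_apply, Int.cast_sub, sub_mul, Finset.sum_sub_distrib]

/-- **The Bernstein coefficient of three hub masses is the cubic of the integer hub table.** -/
theorem coef3_tableZ (Φ₁ Φ₂ Φ₃ : HubFn) (m : (Fin 3 → Bool) → R) (k : Fin 7 → Fin 4) :
    coef3 (tableZ Φ₁ m) (tableZ Φ₂ m) (tableZ Φ₃ m) k = cub (wZ Φ₁ Φ₂ Φ₃ k) m := by
  unfold coef3 tableZ wZ cub
  simp only [sum_mul_sum_mul_sum]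
  simp only [Int.cast_sum, Finset.sum_mul]
  conv_lhs => rw [Finset.sum_comm]
  refine Finset.sum_congr rfl fun π₁ _ => ?_
  conv_lhs => rw [Finset.sum_comm]
  refine Finset.sum_congr rfl fun π₂ _ => ?_
  conv_lhs => rw [Finset.sum_comm]
  refine Finset.sum_congr rfl fun π₃ _ => Finset.sum_congr rfl fun t _ => ?_
  push_cast
  ring

/-- A product of three hub masses is a degree-3 Bernstein form with cubic coefficients. -/
theorem massZ_mul_mul (q : Fin 7 → R) (Φ₁ Φ₂ Φ₃ : HubFn) (m : (Fin 3 → Bool) → R) :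
    massZ q Φ₁ m * massZ q Φ₂ m * massZ q Φ₃ m = ∑ k, bern q k * cub (wZ Φ₁ Φ₂ Φ₃ k) m := by
  unfold massZ
  rw [bform_mul_mul]
  exact Finset.sum_congr rfl fun k _ => by rw [coef3_tableZ]

/-- **The hub table `W_k`**: the signed sum of the eight tables of `GcB`. -/
def Wtot (k : Fin 7 → Fin 4) : Tensor3 :=
  wZ fQ fPD fEQbo k + wZ fQ fDo fEQb3 k - wZ fQ fPD fEQb3o k + wZ fgap fPD fEQo k +
    wZ fgap fDo fEQ3 k - wZ fgap fPD fEQ3o k + wZ fQ fDo fPDb k - wZ fQ fPD fPDbo k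

/-- **The coefficient cubic `C_k(m)`** of the type vector `k`. -/
def Ck (m : (Fin 3 → Bool) → R) (k : Fin 7 → Fin 4) : R := cub (Wtot k) m

/-- `GcB` as the signed sum of its eight triple products. -/
lemma GcB_eq_triples (q : Fin 7 → R) (m : (Fin 3 → Bool) → R) :
    GcB q m =
      massZ q fQ m * massZ q fPD m * massZ q fEQbo m +
        massZ q fQ m * massZ q fDo m * massZ q fEQb3 m -
        massZ q fQ m * massZ q fPD m * massZ q fEQb3o m +
        massZ q fgap m * massZ q fPD m * massZ q fEQo m +
        massZ q fgap m * massZ q fDo m * massZ q fEQ3 m -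
        massZ q fgap m * massZ q fPD m * massZ q fEQ3o m +
        massZ q fQ m * massZ q fDo m * massZ q fPDb m -
        massZ q fQ m * massZ q fPD m * massZ q fPDbo m := by
  unfold GcB
  ring

/-- **The Bernstein–hub expansion**: `GcB q m = Σ_k bern q k · C_k(m)`. -/
theorem GcB_eq_sum (q : Fin 7 → R) (m : (Fin 3 → Bool) → R) :
    GcB q m = ∑ k, bern q k * Ck m k := by
  rw [GcB_eq_triples]
  simp only [massZ_mul_mul, ← Finset.sum_add_distrib, ← Finset.sum_sub_distrib]
  refine Finset.sum_congr rfl fun k _ => ?_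
  unfold Ck Wtot
  simp only [cub_add, cub_sub]
  ring

end Table

section Nonneg

variable {R : Type*} [CommRing R] [PartialOrder R] [IsOrderedRing R]

/-- **Positivity of `GcB` from positivity of the coefficient cubics**: if `q ∈ [0, 1]^7` and
`C_k(m) ≥ 0` for every type vector `k`, then `GcB q m ≥ 0`. -/
theorem GcB_nonneg {q : Fin 7 → R} (hq : ∀ i, 0 ≤ q i ∧ q i ≤ 1) {m : (Fin 3 → Bool) → R}
    (hC : ∀ k, 0 ≤ Ck m k) : 0 ≤ GcB q m := by
  rw [GcB_eq_sum]
  exact Finset.sum_nonneg fun k _ => mul_nonneg (bern_nonneg hq k) (hC k)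

end Nonneg

end Summit.Ventures.PercRepro2.Hub
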